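import Literature.Barriers.SmoothPoincare4.SmallExoticaFrontierReductionLemma8Proofs
import Literature.Topology.FourManifolds.OrientableBoundaryGluing
import Literature.Topology.FourManifolds.TubeTransport
import Literature.Topology.FourManifolds.BoundaryGluingVanKampen
import HarnessLib

/-!
# Akhmedov–Park 2010, Lemma 8: the building blocks through their torus surgeries

Proof file (theorems only, no definition, no named fact) continuing
`SmallExoticaFrontierReductionLemma8Proofs.lean` for the Seiberg–Witten leaf
`Literature.Barriers.SmoothPoincare4.akhmedovPark2010_lemma8_invariants` (A. Akhmedov,
B. D. Park, *Exotic smooth structures on small 4-manifolds with odd signatures*, Invent. Math. 181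
(2010) 577–603 = arXiv:math/0701829, §9 Lemma 8).  §11 of that file
(`akhmedovPark2010_lemma8_invariants_of_tube_fibreSums`) proves the leaf from the two BUILDING
BLOCKS `Y₁(1,1)` and `Z''(1,m)` of `X₁(m) = Y₁(1,1) #_ψ Z''(1,m)` given in tube coordinates —
closed connected smooth `4`-manifolds with a tube `Σ₂ × ℝ² ↪ Yᵢ`, their numbers
`e(Yᵢ) - e(Σ₂)`, `σ(Yᵢ) ∈ {0}, {±1}` and ORIENTATIONS — plus `π₁ = 1` and a separating invariant.
The blocks themselves are torus-surgered copies of the models `Σ₂ × T²` (four Luttinger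
surgeries, eq. (9.1) of the paper) and `T⁴ # ℂℙ²bar` (two torus surgeries, eq. (4.1)), the surgery
tori being disjoint from the surfaces `Σ₂ × {pt}`, `Σ̄₂` and from each other (§2: "The surfaces
`Σ₂ × {pt}` … descend to surfaces in `Yₙ(m)`"; §4: "`Σ̄₂` is still a submanifold of
`Z''(1/q, m/r)`"; §9: "`Σ₂ = Σ₂ × (½, ½) ⊂ Y₁(1/p, 1/q)` … is disjoint from the neighborhoods of
four Luttinger surgery tori").  This file proves that **the block data of §11 pass unchanged
through every such surgery**, so that they need only be established for the MODELS:

* `akhmedovPark2010_lemma8_block_of_tube_regluing` — **one torus surgery step.**  Let `Y` be a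
  closed connected orientable smooth `4`-manifold all of whose orientations have `|σ| = n`,
  `T : F × ℝ² → Y` a tube (the surface to be summed along later) with tube function `g`, and
  `T' : F' × ℝ² → Y` a disjoint tube (the surgery torus, `F'` a closed connected surface with
  finitely generated homology) with tube function `g'`; let the closed smooth `P` be ANY regluing
  of the complement `{¼ ≤ g'}` with the tube piece `{g' ≤ ¼} ≅ F' × D̄²` (a torus surgery with
  arbitrary gluing diffeomorphism of `T³`, in particular every Luttinger / `m`-torus surgery of
  the paper).  Then `P` is connected and `ℤ`-orientable
  (`isOrientableOver_int_of_tube_regluing`, `OrientableBoundaryGluing.lean`), all its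
  orientations have `|σ| = n` (`exists_signature_eq_of_tube_regluing`, Novikov additivity, and
  "a connected manifold has the two orientations `±μ`"), `e(P) = e(Y)`
  (`relEuler_eq_of_tube_regluing`, §10), and `T` survives as a tube `T_P = jA ∘ T` of `P` with a
  tube function (`exists_tube_transport`, `TubeTransport.lean`), `range T_P = jA(M ∩ range T)` —
  so disjointness from further surgery tori is inherited (`disjoint_image_jA_preimage_incl`).
* `akhmedovPark2010_lemma8_invariants_of_orientable_tube_fibreSums` — §11 restated with the
  block data in exactly the form the step theorem outputs (`ℤ`-orientability and `|σ|` instead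
  of chosen orientations and signed values).
* `akhmedovPark2010_lemma8_invariants_of_blocks_vanKampen` (§13) — the same with step (b) in
  the KILLING FORM the paper proves it: instead of `SimplyConnectedSpace (X m)`, sets of loops in
  the two tube complements which normally generate their fundamental groups and die in
  `π₁(X m)` (van Kampen for boundary gluings, `BoundaryGluingVanKampen.lean`).

What is NOT supplied (unchanged from §11, now pushed back to the models): the models `Σ₂ × T²`
(in the tree with `e = 0`, `σ = 0`, orientable: `akhmedovPark2010_exists_sigmaTwo_prod_torus`,
`SmallExoticaFrontierReductionSigmaTwoProofs.lean`) and `T⁴ # ℂℙ²bar` WITH THEIR TUBES (the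
product tube of `Σ₂ × {pt}`, the four Lagrangian tori of (9.1); the surface `Σ̄₂` of §3 and the
two Lagrangian tori of (4.1) — paper-specific smooth constructions), the presentations of the
fundamental groups of the two complements with the relations killing their generators (§§5–9
of the paper: Lemmas 3–5, Thm. 6, eqs. (9.2)–(9.4); §13 takes them as the sets `A m`, `B m`),
and the Seiberg–Witten invariants separating the `X₁(m)`.

## References

* [AkhmedovPark2010] A. Akhmedov, B. D. Park, Invent. Math. 181 (2010) 577–603 =
  arXiv:math/0701829: §2, §4 (eq. (4.1), "`e(Z') = e(Z''(1/q,m/r)) = 1`,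
  `σ(Z') = σ(Z''(1/q,m/r)) = -1`"), §9 (eq. (9.1), Lemma 8 and its proof).
* [GompfStipsiczGSM1999] R. E. Gompf, A. I. Stipsicz, *4-Manifolds and Kirby Calculus*, GSM 20,
  AMS 1999, §8.3 p. 311 (logarithmic transformations / torus surgery).
* [Kirby1989] R. C. Kirby, *The Topology of 4-Manifolds*, LNM 1374 (1989), Ch. II §5, Thm. 5.3
  (Novikov additivity).
-/

noncomputable section

open scoped Manifold ContDiff
open Set Module
open Literature.AlgebraicTopology.SingularHomology
open Literature.Topology.FourManifolds

namespace Literature.Barriers.SmoothPoincare4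

/-! ### §12 One torus surgery step on a block -/

/-- **The block data pass through a torus surgery away from the tube** (Akhmedov–Park 2010,
§2: "the Euler characteristic of `Yₙ(m)` is `4n - 4` and its signature is `0`", "The surfaces
`Σ₂ × {pt}` … descend to surfaces in `Yₙ(m)`"; §4: "`Σ̄₂` is still a submanifold of
`Z''(1/q, m/r)`", "`e(Z') = e(Z''(1/q, m/r)) = 1` and `σ(Z') = σ(Z''(1/q, m/r)) = -1`").  See
the module docstring for the statement; `P` is any regluing of the complement of the surgery
tube `T'` with the tube piece, along any identification of the boundary `F' × S¹`.
[cite: AkhmedovPark2010, §2, §4 and §9] [cite: GompfStipsiczGSM1999, §8.3 p. 311] [cite: Kirby1989, Ch. II §5 Thm. 5.3] -/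
theorem akhmedovPark2010_lemma8_block_of_tube_regluing
    {Y : Type} [TopologicalSpace Y] [T2Space Y] [SecondCountableTopology Y] [CompactSpace Y]
    [ConnectedSpace Y] [ChartedSpace (EuclideanSpace ℝ (Fin 4)) Y] [IsManifold (𝓡 4) ∞ Y]
    -- the kept tube (the surface of the later fibre sum)
    {F : Type} [TopologicalSpace F] [Nonempty F]
    {T : F × EuclideanSpace ℝ (Fin 2) → Y} (hT : Topology.IsEmbedding T) {g : Y → ℝ}
    (hreg : IsRegularLevel (𝓡 4) g (1 / 4)) (hle : ∀ x, g (T x) ≤ 1 / 4 ↔ ‖x.2‖ ≤ 1 / 2)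
    (hlt : ∀ x, g (T x) < 1 / 4 ↔ ‖x.2‖ < 1 / 2) (hout : ∀ y, y ∉ range T → g y = 1)
    -- the surgery tube
    {F' : Type} [TopologicalSpace F'] [T2Space F'] [CompactSpace F'] [ConnectedSpace F']
    [ChartedSpace (EuclideanSpace ℝ (Fin 2)) F'] (hF' : FinRelHomology ℤ ℤ F' ∅ 4)
    {T' : F' × EuclideanSpace ℝ (Fin 2) → Y} (hT' : Topology.IsEmbedding T') {g' : Y → ℝ}
    (hreg' : IsRegularLevel (𝓡 4) g' (1 / 4)) (hle' : ∀ x, g' (T' x) ≤ 1 / 4 ↔ ‖x.2‖ ≤ 1 / 2)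
    (hlt' : ∀ x, g' (T' x) < 1 / 4 ↔ ‖x.2‖ < 1 / 2) (hout' : ∀ y, y ∉ range T' → g' y = 1)
    (hdisj : Disjoint (range T) (range T'))
    -- the numbers of `Y`
    (hY : IsOrientableOver ℤ Y 4) {n : ℕ}
    (hσ : ∀ ν : HomologicalOrientation ℤ Y 4, ν.signature.natAbs = n)
    -- the regluing
    {P : Type} [TopologicalSpace P] [T2Space P] [CompactSpace P]
    [ChartedSpace (EuclideanSpace ℝ (Fin 4)) P] [IsManifold (𝓡 4) ∞ P]
    {φ' : (RegularSublevel.boundaryData hreg'.const_sub).carrier ≃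
      (RegularSublevel.boundaryData hreg').carrier}
    (GP : BoundaryGluingData (RegularSublevel.boundaryData hreg'.const_sub)
      (RegularSublevel.boundaryData hreg') φ' P) :
    ConnectedSpace P ∧ IsOrientableOver ℤ P 4 ∧
      (∀ ν : HomologicalOrientation ℤ P 4, ν.signature.natAbs = n) ∧
      relEuler ℤ ℤ P ∅ = relEuler ℤ ℤ Y ∅ ∧
      ∃ (TP : F × EuclideanSpace ℝ (Fin 2) → P) (gP : P → ℝ),
        Topology.IsEmbedding TP ∧ IsRegularLevel (𝓡 4) gP (1 / 4) ∧
        (∀ x, gP (TP x) ≤ 1 / 4 ↔ ‖x.2‖ ≤ 1 / 2) ∧ (∀ x, gP (TP x) < 1 / 4 ↔ ‖x.2‖ < 1 / 2) ∧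
        (∀ p, p ∉ range TP → gP p = 1) ∧
        range TP = GP.jA '' (RegularSublevel.incl hreg'.const_sub ⁻¹' range T) := by
  haveI : Nonempty F' := ConnectedSpace.toNonempty
  -- the two pieces of the surgery as null-cobordisms of their boundaries
  let bN := RegularSublevel.boundaryData hreg'
  let bM := RegularSublevel.boundaryData hreg'.const_sub
  let cN : NullCobordism 3 bN.carrier :=
    { W := RegularSublevel hreg'
      incl := bN.incl
      isSmoothEmbedding_incl := bN.isSmoothEmbedding
      range_incl := bN.range_incl }
  let cM : NullCobordism 3 bM.carrier :=
    { W := RegularSuperlevel hreg'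
      incl := bM.incl
      isSmoothEmbedding_incl := bM.isSmoothEmbedding
      range_incl := bM.range_incl }
  -- nonempty boundary (the level `T'(F' × S(0, ½))`)
  have hlevel : (g' ⁻¹' {1 / 4}).Nonempty := by
    rw [level_eq_image_tube hle' hlt' hout']
    obtain ⟨v, hv⟩ : (Metric.sphere (0 : EuclideanSpace ℝ (Fin 2)) (1 / 2)).Nonempty :=
      (NormedSpace.sphere_nonempty).2 (by norm_num)
    exact ⟨T' (Classical.arbitrary F', v), (Classical.arbitrary F', v), ⟨mem_univ _, hv⟩, rfl⟩
  obtain ⟨y₀, hy₀⟩ := hlevel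
  simp only [mem_preimage, mem_singleton_iff] at hy₀
  haveI : Nonempty bM.carrier :=
    ⟨⟨RegularSublevel.mk hreg'.const_sub y₀ (by show 1 / 4 - g' y₀ ≤ 0; rw [hy₀]; norm_num),
      (RegularSublevel.mem_boundary_iff hreg'.const_sub _).2
        (by show 1 / 4 - g' y₀ = 0; rw [hy₀]; norm_num)⟩⟩
  -- both pieces are connected, hence so is `P`
  haveI : ConnectedSpace cM.W :=
    connectedSpace_regularSuperlevel_tube (le_refl 2) hT'.continuous hreg' hle' hlt' hout'
  haveI : ConnectedSpace cN.W := by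
    have hpre : IsConnected (g' ⁻¹' Iic (1 / 4)) := by
      rw [preimage_Iic_eq_image_tube hle' hout']
      have hset : {x : F' × EuclideanSpace ℝ (Fin 2) | ‖x.2‖ ≤ 1 / 2} =
          (univ : Set F') ×ˢ Metric.closedBall (0 : EuclideanSpace ℝ (Fin 2)) (1 / 2) := by
        ext x
        simp
      rw [hset]
      refine (isConnected_univ.prod (Metric.isConnected_closedBall ?_)).image _
        hT'.continuous.continuousOn
      norm_num
    haveI : ConnectedSpace ↥(g' ⁻¹' Iic (1 / 4)) := isConnected_iff_connectedSpace.1 hpre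
    exact this
  let GP' : BoundaryGluingData cM.boundaryData cN.boundaryData φ' P := GP
  haveI hconn : ConnectedSpace P := GP'.connectedSpace
  -- orientability (`OrientableBoundaryGluing.lean`)
  have hP : IsOrientableOver ℤ P 4 := isOrientableOver_int_of_tube_regluing hT' hreg' hle' hlt' hout' hY GP
  -- `|σ|` (Novikov additivity, `SignatureCupTrivialPieces.lean`)
  have hσP : ∀ ν : HomologicalOrientation ℤ P 4, ν.signature.natAbs = n := by
    intro ν
    obtain ⟨μ⟩ := hY
    obtain ⟨μ'', h''⟩ := exists_signature_eq_of_tube_regluing hT' hreg' hle' hlt' hout' GP μ ν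
    rw [← hσ μ, ← h'']
    rcases HomologicalOrientation.eq_or_eq_neg_of_connected_holds P ν μ'' with h | h
    · rw [h]
    · rw [h, HomologicalOrientation.signature_neg_holds μ'', Int.natAbs_neg]
  -- `e` (§10)
  have heP : relEuler ℤ ℤ P ∅ = relEuler ℤ ℤ Y ∅ :=
    relEuler_eq_of_tube_regluing hT' hreg' hle' hlt' hout' hF' GP
  -- the tube (`TubeTransport.lean`)
  obtain ⟨TP, gP, hTP, hregP, hleP, hltP, houtP, -, -, -, hrange⟩ :=
    exists_tube_transport hT hreg hle hlt hout hreg' hout' hdisj GP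
  exact ⟨hconn, hP, hσP, heP, TP, gP, hTP, hregP, hleP, hltP, houtP, hrange⟩

/-! ### §12′ The leaf from orientable blocks with `|σ| = 0, 1` -/

/-- **Lemma 8 from the block data in the form produced by the surgery steps** — §11
(`akhmedovPark2010_lemma8_invariants_of_tube_fibreSums`) with the orientations `μᵢ m` of the
blocks and the signed values of `σ` replaced by `ℤ`-orientability and `|σ(Y₁ m)| = 0`,
`|σ(Y₂ m)| = 1` (the outputs of `akhmedovPark2010_lemma8_block_of_tube_regluing`): a family `X m`
of closed simply connected smooth `4`-manifolds, each a boundary gluing of the tube complements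
of tubes `T₁ m : F₁ m × ℝ² → Y₁ m`, `T₂ m : F₂ m × ℝ² → Y₂ m` in closed connected orientable
blocks with `(e(Y₁ m) - e(F₁ m)) + (e(Y₂ m) - e(F₂ m)) = 5`, together with a diffeomorphism
invariant taking infinitely many values on the family, proves
`akhmedovPark2010_lemma8_invariants`. [cite: AkhmedovPark2010, §9, Lemma 8 and its proof] -/
theorem akhmedovPark2010_lemma8_invariants_of_orientable_tube_fibreSums {ι : Type}
    -- the first tubes
    (Y₁ : ι → Type) [∀ m, TopologicalSpace (Y₁ m)] [∀ m, T2Space (Y₁ m)]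
    [∀ m, SecondCountableTopology (Y₁ m)] [∀ m, CompactSpace (Y₁ m)] [∀ m, ConnectedSpace (Y₁ m)]
    [∀ m, ChartedSpace (EuclideanSpace ℝ (Fin 4)) (Y₁ m)] [∀ m, IsManifold (𝓡 4) ∞ (Y₁ m)]
    (F₁ : ι → Type) [∀ m, TopologicalSpace (F₁ m)] [∀ m, T2Space (F₁ m)] [∀ m, CompactSpace (F₁ m)]
    [∀ m, ConnectedSpace (F₁ m)] [∀ m, ChartedSpace (EuclideanSpace ℝ (Fin 2)) (F₁ m)]
    (T₁ : ∀ m, F₁ m × EuclideanSpace ℝ (Fin 2) → Y₁ m) (hT₁ : ∀ m, Topology.IsEmbedding (T₁ m))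
    (g₁ : ∀ m, Y₁ m → ℝ) (hreg₁ : ∀ m, IsRegularLevel (𝓡 4) (g₁ m) (1 / 4))
    (hle₁ : ∀ m x, g₁ m (T₁ m x) ≤ 1 / 4 ↔ ‖x.2‖ ≤ 1 / 2)
    (hlt₁ : ∀ m x, g₁ m (T₁ m x) < 1 / 4 ↔ ‖x.2‖ < 1 / 2)
    (hout₁ : ∀ m y, y ∉ range (T₁ m) → g₁ m y = 1) (hF₁ : ∀ m, FinRelHomology ℤ ℤ (F₁ m) ∅ 4)
    -- the second tubes
    (Y₂ : ι → Type) [∀ m, TopologicalSpace (Y₂ m)] [∀ m, T2Space (Y₂ m)]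
    [∀ m, SecondCountableTopology (Y₂ m)] [∀ m, CompactSpace (Y₂ m)] [∀ m, ConnectedSpace (Y₂ m)]
    [∀ m, ChartedSpace (EuclideanSpace ℝ (Fin 4)) (Y₂ m)] [∀ m, IsManifold (𝓡 4) ∞ (Y₂ m)]
    (F₂ : ι → Type) [∀ m, TopologicalSpace (F₂ m)] [∀ m, T2Space (F₂ m)] [∀ m, CompactSpace (F₂ m)]
    [∀ m, ConnectedSpace (F₂ m)] [∀ m, ChartedSpace (EuclideanSpace ℝ (Fin 2)) (F₂ m)]
    (T₂ : ∀ m, F₂ m × EuclideanSpace ℝ (Fin 2) → Y₂ m) (hT₂ : ∀ m, Topology.IsEmbedding (T₂ m))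
    (g₂ : ∀ m, Y₂ m → ℝ) (hreg₂ : ∀ m, IsRegularLevel (𝓡 4) (g₂ m) (1 / 4))
    (hle₂ : ∀ m x, g₂ m (T₂ m x) ≤ 1 / 4 ↔ ‖x.2‖ ≤ 1 / 2)
    (hlt₂ : ∀ m x, g₂ m (T₂ m x) < 1 / 4 ↔ ‖x.2‖ < 1 / 2)
    (hout₂ : ∀ m y, y ∉ range (T₂ m) → g₂ m y = 1) (hF₂ : ∀ m, FinRelHomology ℤ ℤ (F₂ m) ∅ 4)
    -- the fibre sums
    (X : ι → Type) [∀ m, TopologicalSpace (X m)] [∀ m, T2Space (X m)]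
    [∀ m, SecondCountableTopology (X m)] [∀ m, ChartedSpace (EuclideanSpace ℝ (Fin 4)) (X m)]
    [∀ m, IsManifold (𝓡 4) ∞ (X m)] [∀ m, CompactSpace (X m)] [∀ m, SimplyConnectedSpace (X m)]
    (ψ : ∀ m, (RegularSublevel.boundaryData (hreg₁ m).const_sub).carrier ≃
      (RegularSublevel.boundaryData (hreg₂ m).const_sub).carrier)
    (G : ∀ m, BoundaryGluingData (RegularSublevel.boundaryData (hreg₁ m).const_sub)
      (RegularSublevel.boundaryData (hreg₂ m).const_sub) (ψ m) (X m))
    -- the numbers of the blocks, orientability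
    (he : ∀ m, (relEuler ℤ ℤ (Y₁ m) ∅ - relEuler ℤ ℤ (F₁ m) ∅) +
      (relEuler ℤ ℤ (Y₂ m) ∅ - relEuler ℤ ℤ (F₂ m) ∅) = 5)
    (hσ₁ : ∀ m (ν : HomologicalOrientation ℤ (Y₁ m) 4), ν.signature.natAbs = 0)
    (hσ₂ : ∀ m (ν : HomologicalOrientation ℤ (Y₂ m) 4), ν.signature.natAbs = 1)
    (hO₁ : ∀ m, IsOrientableOver ℤ (Y₁ m) 4) (hO₂ : ∀ m, IsOrientableOver ℤ (Y₂ m) 4)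
    -- the separating diffeomorphism invariant
    {V : Type*} (SW : ι → V) (hSW : ∀ i j, Nonempty (X i ≃ₘ⟮𝓡 4, 𝓡 4⟯ X j) → SW i = SW j)
    (hinf : (range SW).Infinite) :
    akhmedovPark2010_lemma8_invariants := by
  have μ₁ : ∀ m, HomologicalOrientation ℤ (Y₁ m) 4 := fun m => (hO₁ m).some
  have μ₂ : ∀ m, HomologicalOrientation ℤ (Y₂ m) 4 := fun m => (hO₂ m).some
  refine akhmedovPark2010_lemma8_invariants_of_tube_fibreSums Y₁ F₁ T₁ hT₁ g₁ hreg₁ hle₁ hlt₁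
    hout₁ hF₁ Y₂ F₂ T₂ hT₂ g₂ hreg₂ hle₂ hlt₂ hout₂ hF₂ X ψ G he (fun m ν => ?_) (fun m ν => ?_)
    μ₁ μ₂ SW hSW hinf
  · exact Int.natAbs_eq_zero.1 (hσ₁ m ν)
  · rcases Int.natAbs_eq_iff.1 (hσ₂ m ν) with h | h
    · exact Or.inr (by simpa using h)
    · exact Or.inl (by simpa using h)

/-! ### §13 Step (b) in killing form: the leaf from blocks, loops dying in `X₁(m)`, and `SW` -/

/-- **Lemma 8 from the blocks with step (b) in the form the paper proves it** (Akhmedov–Park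
2010, proof of Lemma 8: "From Seifert–Van Kampen theorem, we can deduce that `π₁(X₁(m))` is a
quotient of `π₁(Y₁(1,1) ∖ νΣ₂) ∗ π₁(Z''(1,m) ∖ νΣ̄₂) / ⟨…⟩`", with "`π₁(Y₁(1,1) ∖ νΣ₂, z₁)`
is normally generated by `aᵢ, bᵢ` (`i = 1, 2`) and `c, d`" and Thm. 6 for the other complement,
all these generators being killed in `π₁(X₁(m))` by the relations (9.2), (8.1), (9.3)).
Compared with `akhmedovPark2010_lemma8_invariants_of_orientable_tube_fibreSums` (§12′) the
hypothesis `SimplyConnectedSpace (X m)` is REPLACED by: a base point `z₀ m` on the boundary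
`∂M₁ ≅ F₁ m × S¹` of the first tube complement `M₁ = {¼ ≤ g₁ m}`, and sets `A m ⊆ π₁(M₁, z₀ m)`,
`B m ⊆ π₁(M₂, ψ m (z₀ m))` of loops in the two tube complements which normally generate and
whose images in `π₁(X m)` are trivial — van Kampen for the boundary gluing
(`BoundaryGluingData.simplyConnectedSpace_of_normalClosure_eq_top`,
`BoundaryGluingVanKampen.lean`; the complements are connected,
`connectedSpace_regularSuperlevel_tube`, and so is the boundary `F₁ m × S¹`).  What is NOT
supplied: the blocks with their tubes (models + surgeries, §12), the sets `A m`, `B m` with their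
two properties (the presentations of AP2010 §§5–9: Lemmas 3–5, Thm. 6, eqs. (9.2)–(9.4)), and
the Seiberg–Witten values. [cite: AkhmedovPark2010, §9, Lemma 8 and its proof] [cite: HatcherAT2002, Lemma 1.15] -/
theorem akhmedovPark2010_lemma8_invariants_of_blocks_vanKampen {ι : Type}
    -- the first tubes
    (Y₁ : ι → Type) [∀ m, TopologicalSpace (Y₁ m)] [∀ m, T2Space (Y₁ m)]
    [∀ m, SecondCountableTopology (Y₁ m)] [∀ m, CompactSpace (Y₁ m)] [∀ m, ConnectedSpace (Y₁ m)]
    [∀ m, ChartedSpace (EuclideanSpace ℝ (Fin 4)) (Y₁ m)] [∀ m, IsManifold (𝓡 4) ∞ (Y₁ m)]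
    (F₁ : ι → Type) [∀ m, TopologicalSpace (F₁ m)] [∀ m, T2Space (F₁ m)] [∀ m, CompactSpace (F₁ m)]
    [∀ m, ConnectedSpace (F₁ m)] [∀ m, ChartedSpace (EuclideanSpace ℝ (Fin 2)) (F₁ m)]
    (T₁ : ∀ m, F₁ m × EuclideanSpace ℝ (Fin 2) → Y₁ m) (hT₁ : ∀ m, Topology.IsEmbedding (T₁ m))
    (g₁ : ∀ m, Y₁ m → ℝ) (hreg₁ : ∀ m, IsRegularLevel (𝓡 4) (g₁ m) (1 / 4))
    (hle₁ : ∀ m x, g₁ m (T₁ m x) ≤ 1 / 4 ↔ ‖x.2‖ ≤ 1 / 2)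
    (hlt₁ : ∀ m x, g₁ m (T₁ m x) < 1 / 4 ↔ ‖x.2‖ < 1 / 2)
    (hout₁ : ∀ m y, y ∉ range (T₁ m) → g₁ m y = 1) (hF₁ : ∀ m, FinRelHomology ℤ ℤ (F₁ m) ∅ 4)
    -- the second tubes
    (Y₂ : ι → Type) [∀ m, TopologicalSpace (Y₂ m)] [∀ m, T2Space (Y₂ m)]
    [∀ m, SecondCountableTopology (Y₂ m)] [∀ m, CompactSpace (Y₂ m)] [∀ m, ConnectedSpace (Y₂ m)]
    [∀ m, ChartedSpace (EuclideanSpace ℝ (Fin 4)) (Y₂ m)] [∀ m, IsManifold (𝓡 4) ∞ (Y₂ m)]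
    (F₂ : ι → Type) [∀ m, TopologicalSpace (F₂ m)] [∀ m, T2Space (F₂ m)] [∀ m, CompactSpace (F₂ m)]
    [∀ m, ConnectedSpace (F₂ m)] [∀ m, ChartedSpace (EuclideanSpace ℝ (Fin 2)) (F₂ m)]
    (T₂ : ∀ m, F₂ m × EuclideanSpace ℝ (Fin 2) → Y₂ m) (hT₂ : ∀ m, Topology.IsEmbedding (T₂ m))
    (g₂ : ∀ m, Y₂ m → ℝ) (hreg₂ : ∀ m, IsRegularLevel (𝓡 4) (g₂ m) (1 / 4))
    (hle₂ : ∀ m x, g₂ m (T₂ m x) ≤ 1 / 4 ↔ ‖x.2‖ ≤ 1 / 2)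
    (hlt₂ : ∀ m x, g₂ m (T₂ m x) < 1 / 4 ↔ ‖x.2‖ < 1 / 2)
    (hout₂ : ∀ m y, y ∉ range (T₂ m) → g₂ m y = 1) (hF₂ : ∀ m, FinRelHomology ℤ ℤ (F₂ m) ∅ 4)
    -- the fibre sums (no simple connectivity assumed)
    (X : ι → Type) [∀ m, TopologicalSpace (X m)] [∀ m, T2Space (X m)]
    [∀ m, SecondCountableTopology (X m)] [∀ m, ChartedSpace (EuclideanSpace ℝ (Fin 4)) (X m)]
    [∀ m, IsManifold (𝓡 4) ∞ (X m)] [∀ m, CompactSpace (X m)]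
    (ψ : ∀ m, (RegularSublevel.boundaryData (hreg₁ m).const_sub).carrier ≃
      (RegularSublevel.boundaryData (hreg₂ m).const_sub).carrier)
    (G : ∀ m, BoundaryGluingData (RegularSublevel.boundaryData (hreg₁ m).const_sub)
      (RegularSublevel.boundaryData (hreg₂ m).const_sub) (ψ m) (X m))
    -- the numbers of the blocks, orientability
    (he : ∀ m, (relEuler ℤ ℤ (Y₁ m) ∅ - relEuler ℤ ℤ (F₁ m) ∅) +
      (relEuler ℤ ℤ (Y₂ m) ∅ - relEuler ℤ ℤ (F₂ m) ∅) = 5)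
    (hσ₁ : ∀ m (ν : HomologicalOrientation ℤ (Y₁ m) 4), ν.signature.natAbs = 0)
    (hσ₂ : ∀ m (ν : HomologicalOrientation ℤ (Y₂ m) 4), ν.signature.natAbs = 1)
    (hO₁ : ∀ m, IsOrientableOver ℤ (Y₁ m) 4) (hO₂ : ∀ m, IsOrientableOver ℤ (Y₂ m) 4)
    -- step (b): loops in the two tube complements, normally generating, dying in `X m`
    (z₀ : ∀ m, (RegularSublevel.boundaryData (hreg₁ m).const_sub).carrier)
    (A : ∀ m, Set (FundamentalGroup (RegularSuperlevel (hreg₁ m))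
      ((RegularSublevel.boundaryData (hreg₁ m).const_sub).incl (z₀ m))))
    (B : ∀ m, Set (FundamentalGroup (RegularSuperlevel (hreg₂ m))
      ((RegularSublevel.boundaryData (hreg₂ m).const_sub).incl (ψ m (z₀ m)))))
    (hA : ∀ m, Subgroup.normalClosure (A m) = ⊤) (hB : ∀ m, Subgroup.normalClosure (B m) = ⊤)
    (hA₁ : ∀ m, ∀ a ∈ A m, FundamentalGroup.mapOfEq
      (⟨(G m).jA, (G m).continuous_jA⟩ : C(RegularSuperlevel (hreg₁ m), X m))
      (rfl : (G m).jA ((RegularSublevel.boundaryData (hreg₁ m).const_sub).incl (z₀ m)) =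
        (G m).jA ((RegularSublevel.boundaryData (hreg₁ m).const_sub).incl (z₀ m))) a = 1)
    (hB₁ : ∀ m, ∀ b ∈ B m, FundamentalGroup.mapOfEq
      (⟨(G m).jB, (G m).continuous_jB⟩ : C(RegularSuperlevel (hreg₂ m), X m))
      ((G m).jA_incl (z₀ m)).symm b = 1)
    -- the separating diffeomorphism invariant
    {V : Type*} (SW : ι → V) (hSW : ∀ i j, Nonempty (X i ≃ₘ⟮𝓡 4, 𝓡 4⟯ X j) → SW i = SW j)
    (hinf : (range SW).Infinite) :
    akhmedovPark2010_lemma8_invariants := by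
  -- step (b): each `X m` is simply connected, by van Kampen for the boundary gluing
  haveI hsc : ∀ m, SimplyConnectedSpace (X m) := fun m => by
    haveI : Nonempty (F₁ m) := ConnectedSpace.toNonempty
    haveI : Nonempty (F₂ m) := ConnectedSpace.toNonempty
    let bM₁ := RegularSublevel.boundaryData (hreg₁ m).const_sub
    let bM₂ := RegularSublevel.boundaryData (hreg₂ m).const_sub
    let cM₁ : NullCobordism 3 bM₁.carrier :=
      { W := RegularSuperlevel (hreg₁ m)
        incl := bM₁.incl
        isSmoothEmbedding_incl := bM₁.isSmoothEmbedding
        range_incl := bM₁.range_incl }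
    let cM₂ : NullCobordism 3 bM₂.carrier :=
      { W := RegularSuperlevel (hreg₂ m)
        incl := bM₂.incl
        isSmoothEmbedding_incl := bM₂.isSmoothEmbedding
        range_incl := bM₂.range_incl }
    -- the boundaries: nonempty, compact, Hausdorff, path connected (`≅ Fᵢ m × S¹`)
    haveI : Nonempty bM₁.carrier := ⟨z₀ m⟩
    haveI : Nonempty bM₂.carrier := ⟨ψ m (z₀ m)⟩
    haveI : CompactSpace bM₁.carrier := by
      haveI : CompactSpace ↥((𝓡∂ 4).boundary (RegularSuperlevel (hreg₁ m))) :=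
        isCompact_iff_compactSpace.1
          (isCompact_boundary (n := 3) (W := RegularSuperlevel (hreg₁ m)))
      exact this
    haveI : CompactSpace bM₂.carrier := by
      haveI : CompactSpace ↥((𝓡∂ 4).boundary (RegularSuperlevel (hreg₂ m))) :=
        isCompact_iff_compactSpace.1
          (isCompact_boundary (n := 3) (W := RegularSuperlevel (hreg₂ m)))
      exact this
    haveI : T2Space bM₁.carrier :=
      inferInstanceAs (T2Space ↥((𝓡∂ 4).boundary (RegularSuperlevel (hreg₁ m))))
    haveI : T2Space bM₂.carrier :=
      inferInstanceAs (T2Space ↥((𝓡∂ 4).boundary (RegularSuperlevel (hreg₂ m))))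
    -- (path connected: the boundary is `≅ Fᵢ m × S¹`, `Fᵢ m` a connected manifold)
    haveI : PathConnectedSpace (AddCircle (1 : ℝ)) :=
      (QuotientAddGroup.mk_surjective).pathConnectedSpace continuous_quotient_mk'
    haveI : PathConnectedSpace (F₁ m) := by
      haveI := ChartedSpace.locallyPathConnectedSpace (EuclideanSpace ℝ (Fin 2)) (F₁ m)
      exact pathConnectedSpace_iff_connectedSpace.2 inferInstance
    haveI : PathConnectedSpace (F₂ m) := by
      haveI := ChartedSpace.locallyPathConnectedSpace (EuclideanSpace ℝ (Fin 2)) (F₂ m)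
      exact pathConnectedSpace_iff_connectedSpace.2 inferInstance
    haveI : PathConnectedSpace bM₁.carrier := by
      obtain ⟨e₁⟩ := nonempty_boundary_regularSuperlevel_homeomorph_level (k := 3) (hreg₁ m)
      obtain ⟨e₂⟩ := nonempty_level_homeomorph_prod_addCircle (hT₁ m) (hle₁ m) (hlt₁ m) (hout₁ m)
      haveI : PathConnectedSpace ↥((𝓡∂ 4).boundary (RegularSuperlevel (hreg₁ m))) :=
        (e₁.trans e₂).symm.surjective.pathConnectedSpace (e₁.trans e₂).symm.continuous
      exact this
    haveI : PathConnectedSpace bM₂.carrier := by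
      obtain ⟨e₁⟩ := nonempty_boundary_regularSuperlevel_homeomorph_level (k := 3) (hreg₂ m)
      obtain ⟨e₂⟩ := nonempty_level_homeomorph_prod_addCircle (hT₂ m) (hle₂ m) (hlt₂ m) (hout₂ m)
      haveI : PathConnectedSpace ↥((𝓡∂ 4).boundary (RegularSuperlevel (hreg₂ m))) :=
        (e₁.trans e₂).symm.surjective.pathConnectedSpace (e₁.trans e₂).symm.continuous
      exact this
    -- the complements are path connected
    haveI : PathConnectedSpace cM₁.W := by
      haveI : ConnectedSpace cM₁.W :=
        connectedSpace_regularSuperlevel_tube (le_refl 2) (hT₁ m).continuous (hreg₁ m) (hle₁ m)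
          (hlt₁ m) (hout₁ m)
      haveI := ChartedSpace.locallyPathConnectedSpace (EuclideanHalfSpace 4) cM₁.W
      exact pathConnectedSpace_iff_connectedSpace.2 inferInstance
    haveI : PathConnectedSpace cM₂.W := by
      haveI : ConnectedSpace cM₂.W :=
        connectedSpace_regularSuperlevel_tube (le_refl 2) (hT₂ m).continuous (hreg₂ m) (hle₂ m)
          (hlt₂ m) (hout₂ m)
      haveI := ChartedSpace.locallyPathConnectedSpace (EuclideanHalfSpace 4) cM₂.W
      exact pathConnectedSpace_iff_connectedSpace.2 inferInstance
    let G' : BoundaryGluingData cM₁.boundaryData cM₂.boundaryData (ψ m) (X m) := G m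
    exact G'.simplyConnectedSpace_of_normalClosure_eq_top (z₀ m) (hA m) (hB m) (hA₁ m) (hB₁ m)
  exact akhmedovPark2010_lemma8_invariants_of_orientable_tube_fibreSums Y₁ F₁ T₁ hT₁ g₁ hreg₁ hle₁
    hlt₁ hout₁ hF₁ Y₂ F₂ T₂ hT₂ g₂ hreg₂ hle₂ hlt₂ hout₂ hF₂ X ψ G he hσ₁ hσ₂ hO₁ hO₂ SW hSW hinf

end Literature.Barriers.SmoothPoincare4

end
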